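import Literature.Geometry.Lorentzian.GreenIdentity
import Literature.Geometry.Lorentzian.GradientSection
import Mathlib.LinearAlgebra.Trace
import HarnessLib

/-!
# The divergence of a vector field and the divergence theorem on a closed Riemannian manifold

For a pseudo-Riemannian metric `g` on a manifold `M` with its Levi-Civita connection `∇`
(`LeviCivita.lean`), the **divergence** of a vector field `Y` is the trace of its covariant
differential, `div Y (x) = tr (v ↦ ∇_v Y) ∈ ℝ` (O'Neill 1983, Ch. 3, p. 86, divergence as the
contraction of `∇Y`; Lee 2018, (2.19)–(2.20) and Problem 5-14, `div X = tr(∇X)`,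
`Δu = div(grad u)`). This file defines it (`PseudoRiemannianMetric.vectorDivergence`, the
companion of the divergence of symmetric `2`-tensors `PseudoRiemannianMetric.divergence`) and
PROVES:

* `vectorDivergence_add`, `vectorDivergence_finset_sum`, `vectorDivergence_smul` (Leibniz rule
  `div(uY) = u div Y + du(Y)`, the trace of the rank-one term of `∇(uY) = u∇Y + du ⊗ Y`),
  `vectorDivergence_eq_zero_of_eventuallyEq_zero` (locality) — from Mathlib's axioms of a
  covariant derivative (`IsCovariantDerivativeOn.add/leibniz/congr_of_eventuallyEq`);
* `val_leviCivita_sharp_mvfderiv` — `g(∇_v grad f, w) = Hess f(v, w)` for `f ∈ C²`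
  (metric compatibility and `hessian_apply`), and
  `vectorDivergence_sharp_mvfderiv` — **`div(grad f) = Δ_g f = tr_g Hess f`**
  (`PseudoRiemannianMetric.dalembertian`; Lee 2018, (2.20));
* `chartCoord`, `mvfderiv_chartCoord_localFrame` (`dxʲ(∂ᵢ) = δᵢⱼ`),
  `eq_sum_val_localFrame_smul_sharp_chartCoord` — on a chart domain every tangent vector is
  `w = ∑ⱼ g(w, ∂ⱼ) grad xʲ`;
* `integral_vectorDivergence_smul_of_tsupport_subset`, **`integral_vectorDivergence_eq_zero`** —
  the **divergence theorem on a closed Riemannian manifold**: for a compact Riemannian manifold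
  `(N, h)` without boundary, modelled on `ℝ^m`, and a `C¹` vector field `Y`, `div Y` is continuous
  and `∫_N div Y dμ_h = 0` (Lee 2018, Problem 2-22 with `∂M = ∅`), and the integration by parts
  `integral_mul_vectorDivergence_eq_neg_integral_mvfderiv`: `∫_N u div Y dμ_h = −∫_N du(Y) dμ_h`.

The divergence theorem is REDUCED TO GREEN'S FIRST IDENTITY (`GreenIdentity.lean`,
`∫ u Δf = −∫ h⁻¹(du, df)`): after localisation by a smooth partition of unity subordinate to
chart domains, `ρY = ∑ⱼ uⱼ grad fⱼ` with `uⱼ = ρ h(Y, ∂ⱼ) ∈ C¹(N)` and `fⱼ = ψ xʲ ∈ C^∞(N)` the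
coordinate functions globalised by a cut-off `ψ = 1` near `tsupport ρ` (Mathlib's
`exists_contMDiffMap_zero_one_nhds_of_isClosed`), so that
`div(ρY) = ∑ⱼ (uⱼ Δ fⱼ + h⁻¹(duⱼ, dfⱼ))` integrates to zero summand by summand. No coordinate
formula for `div` is needed. Hypotheses as in `GreenIdentity.lean`: `[CompactSpace N] [T2Space N]
[MeasurableSpace N] [BorelSpace N]`, `h` smooth, `[(ofRiemannian h).HasLeviCivita]`.

Purpose: the divergence theorem is the integration step of the Poincaré–Hopf route to the
Gauss–Bonnet theorem for compact surfaces (the one remaining input,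
`geroch_monotonicity_smooth_of_gaussBonnet` of `IMCFMeanCurvatureEvolution.lean`, of
Huisken–Ilmanen's Geroch monotonicity `geroch_monotonicity_smooth`).

## References

* J. M. Lee, *Introduction to Riemannian Manifolds*, 2nd ed., GTM 176, Springer 2018: (2.19)–(2.20)
  (divergence, Laplacian), Prop. 2.46, Problem 2-22 (divergence theorem), Problem 2-23 (Green's
  identities), Problem 5-14 (`div X = tr ∇X`). [Lee2018]
* B. O'Neill, *Semi-Riemannian geometry with applications to relativity*, Academic Press 1983,
  Ch. 3, p. 86 (divergence), Def. 3.48–3.50 and Lemma 3.49 (Hessian, Laplacian, gradient), p. 60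
  (`♯`, `♭`). [ONeill1983]
-/

noncomputable section

open Bundle Set Function Filter Manifold MeasureTheory Finset FiberBundle
open scoped Manifold ContDiff Topology

namespace Literature.Geometry.Lorentzian

variable {E : Type*} [NormedAddCommGroup E] [NormedSpace ℝ E] {H : Type*} [TopologicalSpace H]
  {I : ModelWithCorners ℝ E H} {M : Type*} [TopologicalSpace M] [ChartedSpace H M]
  [IsManifold I ∞ M] {n : ℕ∞ω}

namespace PseudoRiemannianMetric

section Divergence

variable (g : PseudoRiemannianMetric I n E (TangentSpace I : M → Type _)) [g.HasLeviCivita]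

/-- The **divergence** `div Y (x) = tr (v ↦ ∇_v Y)` of a vector field `Y` on `M` at `x`: the
trace of the covariant differential `∇Y|_x ∈ End(T_x M)` of `Y` for the Levi-Civita connection of
`g` (O'Neill 1983, Ch. 3, p. 86, the divergence as the contraction of `∇Y`; Lee 2018,
(2.19)–(2.20) and Problem 5-14: `div X = tr(∇X)`). No differentiability is assumed (junk values of `∇` off
differentiable sections). [cite: ONeill1983, Ch. 3, p. 86] -/
def vectorDivergence (Y : Π x : M, TangentSpace I x) (x : M) : ℝ :=
  LinearMap.trace ℝ (TangentSpace I x)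
    (g.leviCivita Y x : TangentSpace I x →ₗ[ℝ] TangentSpace I x)

variable {g}

/-- Unfolding lemma for the divergence of a vector field. [folklore] -/
theorem vectorDivergence_def (Y : Π x : M, TangentSpace I x) (x : M) :
    g.vectorDivergence Y x = LinearMap.trace ℝ (TangentSpace I x)
      (g.leviCivita Y x : TangentSpace I x →ₗ[ℝ] TangentSpace I x) := rfl

/-- The divergence of the zero vector field vanishes. [folklore] -/
@[simp]
theorem vectorDivergence_zero (x : M) : g.vectorDivergence (0 : Π x : M, TangentSpace I x) x = 0 := by
  simp [vectorDivergence_def, g.leviCivita.zero]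

/-- **Additivity of the divergence** on vector fields differentiable at the point:
`div (Y + Z) = div Y + div Z`. [folklore] -/
theorem vectorDivergence_add {Y Z : Π x : M, TangentSpace I x} {x : M}
    (hY : MDiffAt (T% Y) x) (hZ : MDiffAt (T% Z) x) :
    g.vectorDivergence (Y + Z) x = g.vectorDivergence Y x + g.vectorDivergence Z x := by
  simp only [vectorDivergence_def, g.leviCivita.isCovariantDerivativeOn.add hY hZ,
    ContinuousLinearMap.toLinearMap_add, map_add]

/-- **Divergence of finite sums** of vector fields differentiable at the point. [folklore] -/
theorem vectorDivergence_finset_sum {ι : Type*} (s : Finset ι)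
    {Y : ι → Π x : M, TangentSpace I x} {x : M} (hY : ∀ i ∈ s, MDiffAt (T% (Y i)) x) :
    MDiffAt (T% (∑ i ∈ s, Y i)) x ∧
      g.vectorDivergence (∑ i ∈ s, Y i) x = ∑ i ∈ s, g.vectorDivergence (Y i) x := by
  classical
  induction s using Finset.induction_on with
  | empty =>
    simp only [Finset.sum_empty, vectorDivergence_zero]
    exact ⟨mdifferentiableAt_zeroSection .., trivial⟩
  | insert a s ha ih =>
    obtain ⟨hd, heq⟩ := ih (fun i hi ↦ hY i (Finset.mem_insert_of_mem hi))
    have ha' : MDiffAt (T% (Y a)) x := hY a (Finset.mem_insert_self a s)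
    rw [Finset.sum_insert ha, Finset.sum_insert ha]
    refine ⟨mdifferentiableAt_add_section ha' hd, ?_⟩
    rw [vectorDivergence_add ha' hd, heq]

/-- **Leibniz rule for the divergence**: `div (u Y)(x) = u(x) div Y(x) + du_x(Y_x)` for `u`
and `Y` differentiable at `x` (the trace of `∇(uY) = u ∇Y + du ⊗ Y`, the second summand being the
rank-one endomorphism `v ↦ du(v) Y_x` of trace `du(Y_x)`). O'Neill 1983, Ch. 3, p. 86;
Lee 2018, Problem 5-14. [cite: ONeill1983, Ch. 3, p. 86] -/
theorem vectorDivergence_smul [FiniteDimensional ℝ E] {Y : Π x : M, TangentSpace I x}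
    {u : M → ℝ} {x : M} (hY : MDiffAt (T% Y) x) (hu : MDiffAt u x) :
    g.vectorDivergence (u • Y) x = u x * g.vectorDivergence Y x + mvfderiv I u x (Y x) := by
  haveI : Module.Finite ℝ (TangentSpace I x) := inferInstanceAs (Module.Finite ℝ E)
  haveI : Module.Free ℝ (TangentSpace I x) := inferInstanceAs (Module.Free ℝ E)
  rw [vectorDivergence_def, vectorDivergence_def,
    g.leviCivita.isCovariantDerivativeOn.leibniz hY hu]
  have h : ((u x • g.leviCivita Y x + (mvfderiv I u x).smulRight (Y x) :
      TangentSpace I x →L[ℝ] TangentSpace I x) : TangentSpace I x →ₗ[ℝ] TangentSpace I x) =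
      u x • (g.leviCivita Y x : TangentSpace I x →ₗ[ℝ] TangentSpace I x) +
        (mvfderiv I u x : TangentSpace I x →ₗ[ℝ] ℝ).smulRight (Y x) :=
    LinearMap.ext fun v ↦ rfl
  rw [h, map_add, map_smul, LinearMap.trace_smulRight, smul_eq_mul]
  rfl

/-- **Locality**: the divergence at `x` of a vector field vanishing near `x` is zero. [folklore] -/
theorem vectorDivergence_eq_zero_of_eventuallyEq_zero {Y : Π x : M, TangentSpace I x} {x : M}
    (hY : ∀ᶠ y in 𝓝 x, Y y = 0) : g.vectorDivergence Y x = 0 := by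
  have h0 : MDiffAt (T% (0 : Π x : M, TangentSpace I x)) x := mdifferentiableAt_zeroSection ..
  have hYd : MDiffAt (T% Y) x := by
    refine h0.congr_of_eventuallyEq ?_
    filter_upwards [hY] with y hy
    simp [hy]
  have := g.leviCivita.isCovariantDerivativeOn.congr_of_eventuallyEq (s := univ) hYd h0
    univ_mem (by filter_upwards [hY] with y hy; simp [hy])
  rw [vectorDivergence_def, this]
  simp [g.leviCivita.zero]

/-! ### The divergence of a gradient is the Laplace–Beltrami operator -/

variable [FiniteDimensional ℝ E] [CompleteSpace E] [I.Boundaryless]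
  {g : PseudoRiemannianMetric I ∞ E (TangentSpace I : M → Type _)} [g.HasLeviCivita]

/-- **`g(∇_v grad f, w) = Hess f (v, w)`**: the covariant differential of the gradient
`grad f = ♯ df` of a `C²` function is the Hessian with an index raised (metric compatibility of
the Levi-Civita connection applied to `g(grad f, W) = W f`, and `hessian_apply`). O'Neill 1983,
Ch. 3, Def. 3.48–Lemma 3.49 (`H^f(X, Y) = ⟨D_X(grad f), Y⟩`). [cite: ONeill1983, Ch. 3, Lemma 3.49] -/
theorem val_leviCivita_sharp_mvfderiv {f : M → ℝ} {x : M} (hf : CMDiffAt 2 f x)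
    (v w : TangentSpace I x) :
    g.val x (g.leviCivita (fun y ↦ (g.sharp y (mvfderiv I f y).toLinearMap : TangentSpace I y))
      x v) w = g.hessian f x v w := by
  set G : Π y : M, TangentSpace I y := fun y ↦ (g.sharp y (mvfderiv I f y).toLinearMap :
    TangentSpace I y) with hG
  have hGd : MDiffAt (T% G) x := g.mdifferentiableAt_sharp_mvfderiv hf
  set X : Π y : M, TangentSpace I y := FiberBundle.extend E v with hX
  set W : Π y : M, TangentSpace I y := FiberBundle.extend E w with hW
  have hXd : MDiffAt (T% X) x := mdifferentiableAt_extend (I := I) E v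
  have hWd : MDiffAt (T% W) x := mdifferentiableAt_extend (I := I) E w
  have hXx : X x = v := extend_apply_self (F := E) v
  have hWx : W x = w := extend_apply_self (F := E) w
  have hcomp := (isLeviCivita_leviCivita_holds (g := g)).2 hXd hGd hWd
  have hpair : (fun y ↦ g.val y (G y) (W y)) = fun y ↦ mvfderiv I f y (W y) := by
    funext y
    simp only [hG, val_sharp_apply, ContinuousLinearMap.coe_coe]
  rw [hpair, hXx, hWx] at hcomp
  have h2 : g.val x (G x) (g.leviCivita W x v) = mvfderiv I f x (g.leviCivita W x v) := by
    simp only [hG, val_sharp_apply, ContinuousLinearMap.coe_coe]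
  rw [h2] at hcomp
  have hH : g.hessian f x v w = g.hessianAux f X W x := by
    have := hessian_apply_holds (g := g) hf hXd hWd
    rwa [hXx, hWx] at this
  rw [hH, hessianAux, hXx]
  linarith

/-- **The divergence of the gradient is the Laplace–Beltrami operator**: for `f` of class `C²`
at `x`, `div (grad f)(x) = □_g f (x) = tr_g Hess f` (`♯ ∘ Hess f|_x = ∇(grad f)|_x` as
endomorphisms of `T_x M`, by `val_leviCivita_sharp_mvfderiv` and nondegeneracy). O'Neill 1983,
Ch. 3, Def. 3.50 ff. (`Δf = div grad f`); Lee 2018, (2.20). [cite: ONeill1983, Ch. 3, Def. 3.50] -/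
theorem vectorDivergence_sharp_mvfderiv {f : M → ℝ} {x : M} (hf : CMDiffAt 2 f x) :
    g.vectorDivergence (fun y ↦ (g.sharp y (mvfderiv I f y).toLinearMap : TangentSpace I y)) x =
      g.dalembertian f x := by
  rw [vectorDivergence_def, dalembertian, trace]
  congr 1
  refine LinearMap.ext fun v ↦ ?_
  apply g.flat_injective x
  refine LinearMap.ext fun w ↦ ?_
  simp only [LinearMap.coe_comp, Function.comp_apply, flat_apply, ContinuousLinearMap.coe_coe,
    LinearEquiv.coe_coe, val_sharp_apply]
  exact g.val_leviCivita_sharp_mvfderiv hf v w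

end Divergence

/-! ### Expansion of a tangent vector in the gradients of the coordinate functions -/

section Frame

variable [FiniteDimensional ℝ E] [I.Boundaryless]
  (g : PseudoRiemannianMetric I n E (TangentSpace I : M → Type _))
  {ι : Type*} [Fintype ι] [DecidableEq ι] (b : Module.Basis ι ℝ E) {x₀ p : M}

/-- The `j`-th **coordinate function** of the chart at `x₀` with respect to the basis `b` of the
model space: `y ↦ bʲ(φ(y))`, `φ = extChartAt I x₀`, `bʲ` the dual basis functional (a junk
value off the chart domain, where `extChartAt` is arbitrary). O'Neill 1983, Ch. 1, Def. 1.9 ff.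
(coordinate functions `xⁱ = uⁱ ∘ ξ`). [cite: ONeill1983, Ch. 1, Def. 1.9 ff] -/
def chartCoord (b : Module.Basis ι ℝ E) (x₀ : M) (j : ι) (y : M) : ℝ :=
  LinearMap.toContinuousLinearMap (b.coord j) (extChartAt I x₀ y)

omit [IsManifold I ∞ M] [I.Boundaryless] [Fintype ι] [DecidableEq ι] in
/-- Unfolding lemma for `chartCoord`. [folklore] -/
theorem chartCoord_apply (j : ι) (y : M) :
    chartCoord (I := I) b x₀ j y = b.coord j (extChartAt I x₀ y) := rfl

omit [I.Boundaryless] [Fintype ι] [DecidableEq ι] in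
/-- The coordinate functions are `C^∞` on the chart domain. [folklore] -/
theorem contMDiffAt_chartCoord (hp : p ∈ (chartAt H x₀).source) (j : ι) :
    CMDiffAt ∞ (chartCoord (I := I) b x₀ j) p :=
  ((LinearMap.toContinuousLinearMap (b.coord j)).contDiff.contMDiff.contMDiffAt).comp p
    (contMDiffAt_extChartAt' hp)

omit [Fintype ι] in
/-- **The differentials of the coordinate functions are dual to the coordinate frame**:
`d(xʲ)_p(∂ᵢ|_p) = δᵢⱼ` on the chart domain. O'Neill 1983, Ch. 1, Def. 1.9 ff.
[cite: ONeill1983, Ch. 1, Def. 1.9 ff] -/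
theorem mvfderiv_chartCoord_localFrame (hp : p ∈ (chartAt H x₀).source) (i j : ι) :
    mvfderiv I (chartCoord (I := I) b x₀ j) p
        ((trivializationAt E (TangentSpace I) x₀).localFrame b i p) =
      if i = j then 1 else 0 := by
  have hps : p ∈ (extChartAt I x₀).source := by simpa [extChartAt_source] using hp
  have hd : MDifferentiableAt I 𝓘(ℝ, ℝ) (chartCoord (I := I) b x₀ j) p :=
    (contMDiffAt_chartCoord b hp j).mdifferentiableAt (by simp)
  have hFh : (LinearMap.toContinuousLinearMap (b.coord j) : E → ℝ) =ᶠ[𝓝 (extChartAt I x₀ p)]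
      chartCoord (I := I) b x₀ j ∘ (extChartAt I x₀).symm := by
    filter_upwards [(isOpen_extChartAt_target x₀).mem_nhds ((extChartAt I x₀).map_source hps)]
      with z hz
    simp only [Function.comp_apply, chartCoord, (extChartAt I x₀).right_inv hz]
  rw [mvfderiv_apply_localFrame_of_eventuallyEq b hp hd hFh, ContinuousLinearMap.fderiv,
    LinearMap.coe_toContinuousLinearMap', Module.Basis.coord_apply, Module.Basis.repr_self,
    Finsupp.single_apply]

omit [FiniteDimensional ℝ E] [I.Boundaryless] [DecidableEq ι] in
/-- A tangent vector at a point of the chart domain is determined by its pairings with the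
coordinate frame (nondegeneracy of `g_p` and the frame being a basis). [folklore] -/
theorem eq_of_forall_val_localFrame_eq (hp : p ∈ (chartAt H x₀).source) {v w : TangentSpace I p}
    (h : ∀ i, g.val p v ((trivializationAt E (TangentSpace I) x₀).localFrame b i p) =
      g.val p w ((trivializationAt E (TangentSpace I) x₀).localFrame b i p)) : v = w := by
  have hpe : p ∈ (trivializationAt E (TangentSpace I) x₀).baseSet := by simpa using hp
  set β : Module.Basis ι ℝ (TangentSpace I p) :=
    (trivializationAt E (TangentSpace I) x₀).basisAt b hpe with hβ_def
  have hβ : ∀ l, (trivializationAt E (TangentSpace I) x₀).localFrame b l p = β l := fun l ↦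
    Trivialization.localFrame_apply_of_mem_baseSet _ b hpe
  simp only [hβ] at h
  rw [← sub_eq_zero]
  refine g.nondegenerate p (v - w) fun u ↦ ?_
  rw [← β.sum_repr u]
  simp only [map_sum, map_smul, smul_eq_mul, map_sub, FunLike.coe_sub, Pi.sub_apply,
    h, sub_self, mul_zero, Finset.sum_const_zero]

omit [DecidableEq ι] in
/-- **Expansion of a tangent vector in the gradients of the coordinate functions**: for `p` in
the chart domain of `x₀`, every `w ∈ T_p M` is `w = ∑ⱼ g_p(w, ∂ⱼ) ♯(dxʲ)_p` — lowering the index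
with `g` against the coordinate frame and raising it back with the dual coframe `dxʲ`
(`g(♯dxʲ, ∂ᵢ) = dxʲ(∂ᵢ) = δᵢⱼ`). O'Neill 1983, Ch. 3, p. 60 and Ch. 1, Def. 1.9 ff.
[cite: ONeill1983, Ch. 3, p. 60] -/
theorem eq_sum_val_localFrame_smul_sharp_chartCoord (hp : p ∈ (chartAt H x₀).source)
    (w : TangentSpace I p) :
    w = ∑ j, g.val p w ((trivializationAt E (TangentSpace I) x₀).localFrame b j p) •
      g.sharp p (mvfderiv I (chartCoord (I := I) b x₀ j) p).toLinearMap := by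
  classical
  refine g.eq_of_forall_val_localFrame_eq b hp fun i ↦ ?_
  simp only [map_sum, map_smul, smul_eq_mul, FunLike.coe_sum, Finset.sum_apply,
    FunLike.coe_smul, Pi.smul_apply, val_sharp_apply, ContinuousLinearMap.coe_coe,
    mvfderiv_chartCoord_localFrame b hp, mul_ite, mul_one, mul_zero, Finset.sum_ite_eq,
    Finset.mem_univ, if_true]

end Frame


end PseudoRiemannianMetric

/-! ### The divergence theorem on a closed Riemannian manifold -/

section Compact

open PseudoRiemannianMetric

variable {m : ℕ} {H : Type*} [TopologicalSpace H]
  {I : ModelWithCorners ℝ (EuclideanSpace ℝ (Fin m)) H} [I.Boundaryless]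
  {N : Type*} [TopologicalSpace N] [ChartedSpace H N] [IsManifold I ∞ N] [CompactSpace N]
  [T2Space N] [MeasurableSpace N] [BorelSpace N]
  (h : ContMDiffRiemannianMetric I ∞ (EuclideanSpace ℝ (Fin m)) (TangentSpace I : N → Type _))
  [(ofRiemannian h).HasLeviCivita]

/-- **The divergence theorem for a vector field localized in a chart domain.** On a compact
Riemannian manifold `(N, h)` modelled on `ℝ^m` (boundaryless), for a `C¹` vector field `Y` and
`ρ ∈ C¹(N)` with `tsupport ρ` inside the chart domain of `x₀`, the divergence of `ρ Y` is
continuous and `∫_N div(ρ Y) dμ_h = 0`. Proof: on the chart domain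
`ρ Y = ∑ⱼ (ρ h(Y, ∂ⱼ)) grad fⱼ` with `fⱼ = ψ xʲ` global `C^∞` functions equal to the coordinate
functions near `tsupport ρ` (`ψ` a smooth cut-off, `eq_sum_val_localFrame_smul_sharp_chartCoord`),
so `div(ρ Y) = ∑ⱼ (uⱼ Δ_h fⱼ + h⁻¹(duⱼ, dfⱼ))`, `uⱼ = ρ h(Y, ∂ⱼ)` (`vectorDivergence_smul`,
`vectorDivergence_sharp_mvfderiv`), and each summand integrates to zero by Green's first identity
(`integral_mul_dalembertian_eq_neg_integral_innerDual`). Lee 2018, Problem 2-22 (divergence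
theorem), here with `∂N = ∅`. [cite: Lee2018, Problem 2-22 (a)] -/
theorem integral_vectorDivergence_smul_of_tsupport_subset (x₀ : N) {ρ : N → ℝ} (hρ : CMDiff 1 ρ)
    (hsupp : tsupport ρ ⊆ (chartAt H x₀).source) {Y : Π x : N, TangentSpace I x}
    (hY : CMDiff 1 (T% Y)) :
    Continuous ((ofRiemannian h).vectorDivergence (ρ • Y)) ∧
      ∫ p, (ofRiemannian h).vectorDivergence (ρ • Y) p ∂riemannianMeasure h = 0 := by
  classical
  set g := ofRiemannian h with hg
  set b : Module.Basis (Fin m) ℝ (EuclideanSpace ℝ (Fin m)) :=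
    (EuclideanSpace.basisFun (Fin m) ℝ).toBasis with hb_def
  set U : Set N := (chartAt H x₀).source with hU
  have hUo : IsOpen U := (chartAt H x₀).open_source
  -- a smooth cut-off `ψ = 1` near `tsupport ρ` with `tsupport ψ ⊆ U`
  obtain ⟨ψ, hψ0, hψ1, -⟩ := exists_contMDiffMap_zero_one_nhds_of_isClosed I (n := (⊤ : ℕ∞))
    hUo.isClosed_compl (isClosed_tsupport ρ) (disjoint_compl_left_iff_subset.2 hsupp)
  obtain ⟨O, hO, hUO, hψO⟩ := eventually_nhdsSet_iff_exists.1 hψ0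
  have hψsupp : tsupport ψ ⊆ U := by
    refine closure_minimal (fun y hy ↦ ?_) hO.isClosed_compl |>.trans fun y hy ↦ ?_
    · exact fun hyO ↦ hy (hψO y hyO)
    · by_contra hyU; exact hy (hUO hyU)
  obtain ⟨O₁, hO₁, htO₁, hψO₁⟩ := eventually_nhdsSet_iff_exists.1 hψ1
  -- the globalized coordinate functions `fⱼ = ψ xʲ`
  set f : Fin m → N → ℝ := fun j y ↦ ψ y * chartCoord (I := I) b x₀ j y with hf_def
  have hf : ∀ j, CMDiff ∞ (f j) := fun j ↦ by
    refine contMDiff_of_tsupport fun y hy ↦ ?_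
    have hyU : y ∈ U := hψsupp (tsupport_mul_subset_left hy)
    exact ψ.contMDiff.contMDiffAt.mul (contMDiffAt_chartCoord b hyU j)
  have h2 : (2 : ℕ∞ω) ≤ ∞ := WithTop.coe_le_coe.mpr le_top
  have h1 : (1 : ℕ∞ω) ≤ ∞ := WithTop.coe_le_coe.mpr le_top
  have hf2 : ∀ j, CMDiff 2 (f j) := fun j ↦ (hf j).of_le h2
  have hf1 : ∀ j, CMDiff 1 (f j) := fun j ↦ (hf j).of_le h1
  have hfev : ∀ j, ∀ y ∈ tsupport ρ, f j =ᶠ[𝓝 y] chartCoord (I := I) b x₀ j := fun j y hy ↦ by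
    filter_upwards [hO₁.mem_nhds (htO₁ hy)] with z hz
    simp only [hf_def, hψO₁ z hz, one_mul]
  -- the coefficient functions `uⱼ = ρ h(Y, ∂ⱼ)`
  set s : Fin m → Π x : N, TangentSpace I x := fun j ↦
    (trivializationAt (EuclideanSpace ℝ (Fin m)) (TangentSpace I) x₀).localFrame b j with hs_def
  set u : Fin m → N → ℝ := fun j y ↦ ρ y * g.val y (Y y) (s j y) with hu_def
  have hu : ∀ j, CMDiff 1 (u j) := fun j ↦ by
    refine contMDiff_of_tsupport fun y hy ↦ ?_
    have hyU : y ∈ U := hsupp (tsupport_mul_subset_left hy)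
    exact hρ.contMDiffAt.mul (g.contMDiffAt_val_apply h1 hY.contMDiffAt
      ((contMDiffAt_localFrame_chart b hyU j).of_le h1))
  -- the gradients `Gⱼ = grad fⱼ`
  set G : Fin m → Π x : N, TangentSpace I x := fun j y ↦
    (g.sharp y (mvfderiv I (f j) y).toLinearMap : TangentSpace I y) with hG_def
  have hGd : ∀ j y, MDiffAt (T% (G j)) y := fun j y ↦
    g.mdifferentiableAt_sharp_mvfderiv ((hf2 j) y)
  -- the decomposition `ρ Y = ∑ⱼ uⱼ Gⱼ`
  have hdec : (ρ • Y : Π x : N, TangentSpace I x) = ∑ j, u j • G j := by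
    funext y
    rw [Finset.sum_apply]
    simp only [Pi.smul_apply']
    by_cases hy : y ∈ tsupport ρ
    · have hyU : y ∈ U := hsupp hy
      have hGj : ∀ j, G j y = g.sharp y (mvfderiv I (chartCoord (I := I) b x₀ j) y).toLinearMap :=
        fun j ↦ by simp only [hG_def, mvfderiv_congr_of_eventuallyEq (hfev j y hy)]
      simp only [hu_def, hGj, mul_smul, ← Finset.smul_sum]
      congr 1
      exact g.eq_sum_val_localFrame_smul_sharp_chartCoord b hyU (Y y)
    · have h0 : ρ y = 0 := image_eq_zero_of_notMem_tsupport hy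
      have hu0 : ∀ j, u j y = 0 := fun j ↦ by simp only [hu_def, h0, zero_mul]
      rw [h0, zero_smul]
      exact (Finset.sum_eq_zero fun j _ ↦ by rw [hu0 j, zero_smul]).symm
  -- the divergence, summand by summand
  have hdiv : ∀ y, g.vectorDivergence (ρ • Y) y =
      ∑ j, (u j y * g.dalembertian (f j) y +
        g.innerDual y (mvfderiv I (u j) y).toLinearMap (mvfderiv I (f j) y).toLinearMap) := by
    intro y
    rw [hdec, (vectorDivergence_finset_sum (g := g) Finset.univ (fun j _ ↦
      ((hu j y).mdifferentiableAt one_ne_zero).smul_section (hGd j y))).2]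
    refine Finset.sum_congr rfl fun j _ ↦ ?_
    rw [vectorDivergence_smul (hGd j y) ((hu j y).mdifferentiableAt one_ne_zero),
      vectorDivergence_sharp_mvfderiv ((hf2 j) y)]
    rfl
  have heq : g.vectorDivergence (ρ • Y) = fun y ↦ ∑ j, (u j y * g.dalembertian (f j) y +
      g.innerDual y (mvfderiv I (u j) y).toLinearMap (mvfderiv I (f j) y).toLinearMap) :=
    funext hdiv
  have hcont : Continuous (g.vectorDivergence (ρ • Y)) := by
    rw [heq]
    refine continuous_finsetSum _ fun j _ ↦ ?_
    exact ((hu j).continuous.mul (continuous_dalembertian _ (hf2 j))).add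
      (continuous_innerDual_mvfderiv _ (hu j) (hf1 j))
  refine ⟨hcont, ?_⟩
  have hi1 : ∀ j, Integrable (fun a ↦ u j a * g.dalembertian (f j) a) (riemannianMeasure h) :=
    fun j ↦ integrable_of_continuous h (show Continuous (fun a ↦ u j a * g.dalembertian (f j) a)
      from (hu j).continuous.mul (continuous_dalembertian _ (hf2 j)))
  have hi2 : ∀ j, Integrable (fun a ↦ g.innerDual a (mvfderiv I (u j) a).toLinearMap
      (mvfderiv I (f j) a).toLinearMap) (riemannianMeasure h) :=
    fun j ↦ integrable_of_continuous h (continuous_innerDual_mvfderiv _ (hu j) (hf1 j))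
  have hi : ∀ j, Integrable (fun a ↦ u j a * g.dalembertian (f j) a + g.innerDual a
      (mvfderiv I (u j) a).toLinearMap (mvfderiv I (f j) a).toLinearMap) (riemannianMeasure h) :=
    fun j ↦ (hi1 j).add (hi2 j)
  rw [heq]
  beta_reduce
  rw [integral_finsetSum _ (fun j _ ↦ hi j)]
  refine Finset.sum_eq_zero fun j _ ↦ ?_
  rw [integral_add (hi1 j) (hi2 j), integral_mul_dalembertian_eq_neg_integral_innerDual h (hu j)
    (hf2 j)]
  ring

/-- **The divergence theorem on a closed Riemannian manifold.** For a compact Riemannian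
manifold `(N, h)` without boundary (modelled on `ℝ^m`, boundaryless model) and a `C¹` vector
field `Y` on `N`, the divergence `div Y = tr ∇Y` (Levi-Civita connection) is continuous and
`∫_N div Y dμ_h = 0`, `μ_h` the Riemannian measure. Proof: a finite smooth partition of unity
`(ρᵢ)` subordinate to chart domains (Mathlib's `SmoothPartitionOfUnity.exists_isSubordinate`)
gives `Y = ∑ᵢ ρᵢ Y`, `div Y = ∑ᵢ div(ρᵢ Y)` (`vectorDivergence_finset_sum`), and each piece
integrates to zero (`integral_vectorDivergence_smul_of_tsupport_subset`). Lee 2018, Problem 2-22 (a)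
("divergence theorem", `∫_M div X dV_g = ∫_{∂M} ⟨X, N⟩_g dV_ĝ`; here `∂M = ∅`).
[cite: Lee2018, Problem 2-22 (a)] -/
theorem integral_vectorDivergence_eq_zero {Y : Π x : N, TangentSpace I x} (hY : CMDiff 1 (T% Y)) :
    Continuous ((ofRiemannian h).vectorDivergence Y) ∧
      ∫ p, (ofRiemannian h).vectorDivergence Y p ∂riemannianMeasure h = 0 := by
  classical
  -- a finite subcover of `N` by chart domains and a smooth partition of unity subordinate to it
  obtain ⟨t, ht⟩ := CompactSpace.elim_nhds_subcover (fun x : N ↦ (chartAt H x).source)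
    (fun x ↦ (chartAt H x).open_source.mem_nhds (mem_chart_source H x))
  obtain ⟨ρ, hρ⟩ := SmoothPartitionOfUnity.exists_isSubordinate I isClosed_univ
    (fun i : t ↦ (chartAt H (i : N)).source) (fun i ↦ (chartAt H (i : N)).open_source) (by
      intro p _
      have hp : p ∈ ⋃ x ∈ t, (chartAt H x).source := by rw [ht]; trivial
      simp only [mem_iUnion] at hp ⊢
      obtain ⟨x, hx, hpx⟩ := hp
      exact ⟨⟨x, hx⟩, hpx⟩)
  have hsum : ∀ p, ∑ i, ρ i p = 1 := fun p ↦ by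
    rw [← finsum_eq_sum_of_fintype]
    exact ρ.sum_eq_one (mem_univ p)
  have hρ1 : ∀ i, CMDiff 1 (ρ i) := fun i ↦ (ρ i).contMDiff.of_le (by exact_mod_cast le_top)
  have hpiece := fun i : t ↦ integral_vectorDivergence_smul_of_tsupport_subset h (i : N) (hρ1 i)
    (hρ i) hY
  -- `Y = ∑ᵢ ρᵢ Y` and `div Y = ∑ᵢ div (ρᵢ Y)`
  have hdec : Y = ∑ i, ((ρ i : N → ℝ) • Y : Π x : N, TangentSpace I x) := by
    funext p
    rw [Finset.sum_apply]
    simp only [Pi.smul_apply', ← Finset.sum_smul, hsum p, one_smul]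
  have hdiv : (ofRiemannian h).vectorDivergence Y =
      fun p ↦ ∑ i, (ofRiemannian h).vectorDivergence ((ρ i : N → ℝ) • Y) p := by
    funext p
    conv_lhs => rw [hdec]
    exact (vectorDivergence_finset_sum (g := ofRiemannian h) Finset.univ (fun i _ ↦
      (((hρ1 i) p).mdifferentiableAt one_ne_zero).smul_section
        ((hY p).mdifferentiableAt one_ne_zero))).2
  refine ⟨?_, ?_⟩
  · rw [hdiv]
    exact continuous_finsetSum _ fun i _ ↦ (hpiece i).1
  · rw [hdiv, integral_finsetSum _ (fun i _ ↦ integrable_of_continuous h (hpiece i).1)]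
    exact Finset.sum_eq_zero fun i _ ↦ (hpiece i).2

/-- **Integration by parts against a vector field** on a closed Riemannian manifold: for
`u ∈ C¹(N)` and a `C¹` vector field `Y`, `∫_N u div Y dμ_h = −∫_N du(Y) dμ_h` (the divergence
theorem for `u Y`, `div(uY) = u div Y + du(Y)`). Lee 2018, Problem 2-22 (a).
[cite: Lee2018, Problem 2-22 (a)] -/
theorem integral_mul_vectorDivergence_eq_neg_integral_mvfderiv {u : N → ℝ} (hu : CMDiff 1 u)
    {Y : Π x : N, TangentSpace I x} (hY : CMDiff 1 (T% Y)) :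
    ∫ p, u p * (ofRiemannian h).vectorDivergence Y p ∂riemannianMeasure h =
      -∫ p, mvfderiv I u p (Y p) ∂riemannianMeasure h := by
  have huY : CMDiff 1 (T% ((u : N → ℝ) • Y : Π x : N, TangentSpace I x)) := hu.smul_section hY
  obtain ⟨hcY, -⟩ := integral_vectorDivergence_eq_zero h hY
  obtain ⟨hc, h0⟩ := integral_vectorDivergence_eq_zero h huY
  have heq : (ofRiemannian h).vectorDivergence ((u : N → ℝ) • Y) =
      fun p ↦ u p * (ofRiemannian h).vectorDivergence Y p + mvfderiv I u p (Y p) :=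
    funext fun p ↦ vectorDivergence_smul ((hY p).mdifferentiableAt one_ne_zero)
      ((hu p).mdifferentiableAt one_ne_zero)
  have hi1 : Integrable (fun p ↦ u p * (ofRiemannian h).vectorDivergence Y p)
      (riemannianMeasure h) :=
    integrable_of_continuous h (show Continuous fun p ↦ u p * (ofRiemannian h).vectorDivergence Y p
      from hu.continuous.mul hcY)
  have hi2 : Integrable (fun p ↦ mvfderiv I u p (Y p)) (riemannianMeasure h) := by
    have hc2 : Continuous (fun p ↦ u p * (ofRiemannian h).vectorDivergence Y p +
        mvfderiv I u p (Y p)) := by rw [← heq]; exact hc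
    have := hc2.sub (show Continuous fun p ↦ u p * (ofRiemannian h).vectorDivergence Y p
      from hu.continuous.mul hcY)
    refine integrable_of_continuous h (this.congr fun p ↦ ?_)
    simp only [Pi.sub_apply, add_sub_cancel_left]
  rw [heq, integral_add hi1 hi2] at h0
  linarith

end Compact




end Literature.Geometry.Lorentzian

end
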